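import Literature.AlgebraicGeometry.Motives.AbelianVarietyIsogenyFactorisationPoints
import Literature.AlgebraicGeometry.Motives.AbelianVarietyTorsion
import HarnessLib

/-!
# Dividing a homomorphism of abelian varieties by an integer ON POINTS: if `φ ∘ P = Q ∘ [n]` for torsion
# parametrisations `P`, `Q`, then `φ = n • χ` with `χ ∘ P = Q` (Milne 1986 Lemma 12.6; Shimura 1998 §7.1 / §18.6)

Topic `Literature/AlgebraicGeometry/Motives`, namespace `Literature.AlgebraicGeometry.Motives.AbelianVariety`.
PROOF-ONLY file (no definition, no named fact, no instance; net Literature debt 0).  Cell `hodgecm-mathlib`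
(D-0151), #60 road (MUMFORD-LINE-SPEC §8, M3a `hmod_of_isModuli` / the `iso` data goal of the M3 head
`IsModuli R → IsCanonical R`): the DIVISION STEP of the reciprocity law at CM points.  There the homomorphism
`f₀ : A_{J,a}^σ → A_{J,r·a}` obtained by summing, over the factors `Kᵢ` of the CM algebra `F = ∏ᵢ Kᵢ`, the
composites «project to a principal `(Kᵢ, Φᵢ, 𝔟ᵢ)`-structure, apply Shimura's Thm. 18.6 (2) with its `ξ′`, go back with
the scalar `M` of a lattice sandwich `M·⊕ᵢ𝔟ᵢ ⊆ Λ_a ⊆ ⊕ᵢ𝔟ᵢ`» satisfies `f₀(σ(u_a(x))) = u_{r·a}(M·N_Φ(s)·x)` for all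
`x ∈ F`, i.e. it is the wanted isomorphism of marked varieties COMPOSED WITH `[M]`; this file removes the `[M]`.

## What is proved (abelian varieties `A, B` over a field `K` of characteristic `0`, `L ⊇ K` algebraically closed)

* §1 bookkeeping on `L`-points: `χ(R·S) = χ(R)·χ(S)` (`map_hom_mul`), `χ(Rⁿ) = χ(R)ⁿ` (`map_hom_zpow`),
  `(n • χ)(R) = χ(R)ⁿ` (`map_zsmul_hom`), `(Σᵢ uᵢ)(R) = ∏ᵢ uᵢ(R)` (`map_hom_finset_sum`, the ASSEMBLY step of M3a:
  `f₀ = Σᵢ χᵢ^σ ≫ θᵢ` over the factors of the CM algebra), and an additive parametrisation `P : V → A(L)` satisfies `P(n • x) = P(x)ⁿ` (`apply_nsmul_eq_pow_of_add`).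
* §2 **`exists_eq_zsmul_and_map_eq_of_map_eq_nsmul`** — let `V` be an additive group divisible by `n ≥ 1`
  (`∀ x, ∃ y, n • y = x`; e.g. a `ℚ`-vector space), `P : V → A(L)` ADDITIVE and `Q : V → B(L)`
  (`P (x + y) = P x · P y`; `Q` any map) such that (i) every `n`-torsion point of `A(L)` is a value of `P`, (ii) `Ker P ⊆ Ker Q`,
  and `φ : A → B` a homomorphism with (iii) `φ(P x) = Q(n • x)` for all `x`.  Then there is `χ : A → B` with
  `φ = n • χ` AND `χ(P x) = Q x` for all `x`.  Proof: by (i)–(iii) `φ` kills `A[n](L)` (`T = P x`, `P(n•x) = Tⁿ = 1`,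
  so `Q(n•x) = 1`), hence `φ = n • χ` by Milne's Lemma 12.6 (★ `exists_eq_zsmul_of_forall_torsionPoints_of_isAlgClosed`);
  and for `x = n • y`, `χ(P x) = χ(P y)ⁿ = (n•χ)(P y) = φ(P y) = Q(n • y) = Q x`.
  Variant `exists_map_eq_of_map_eq_nsmul` (only the conclusion `χ ∘ P = Q`), and uniqueness of such a `χ` when
  `P` reaches all torsion points of every order (`unique` is not needed downstream and is not stated).

This is the abstract form of the last step of [Shimura1998] Thm. 18.6's proof (p. 128: «it is sufficient to prove
the case `ι(𝔬) ⊂ End(A)`», reduction through an isogeny and division) and of [Milne2005ShimuraVarieties] Thm. 11.2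
(«there is a unique `E`-linear isogeny `α : A → σA` such that `α(N_Φ(s)·x) = σx` for all `x ∈ V_f A`» — `α` is
obtained from an integral isogeny by dividing by an integer), with the torsion parametrisations abstracted into
`P` and `Q`; on points it is Milne 1986 Lemma 12.6.

## References
* [Milne1986AbelianVarieties] J. S. Milne, *Abelian Varieties* (in Cornell–Silverman 1986), §12 Lemma 12.6 (PDF p. 191),
  §8 Rem. 8.12.
* [Shimura1998] G. Shimura, *Abelian Varieties with Complex Multiplication and Modular Functions* (1998), §7.1 Prop. 7
  p. 47; §18.6, proof of Thm. 18.6 p. 128.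
* [Milne2005ShimuraVarieties] J. S. Milne, *Introduction to Shimura varieties* (2005), §11 Thm. 11.2 p. 108.
* [GortzWedhorn2023] U. Görtz, T. Wedhorn, *Algebraic Geometry II* (2023), (27.35.2).
-/

noncomputable section

open CategoryTheory AlgebraicGeometry
open scoped MonObj

universe u

namespace Literature.AlgebraicGeometry.Motives.AbelianVariety

/-! ### §1 Bookkeeping on `L`-points -/

section Points

variable {K : Type u} [Field K] {A B : AbelianVariety K} {L : Type u} [Field L] [Algebra K L]

/-- **A homomorphism is multiplicative on `L`-points**: `χ(R · S) = χ(R) · χ(S)` (the group law on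
`A(L) = Hom(Spec L, A)` is induced by that of `A`; Mathlib `IsMonHom.monoidHom`).
[cite: GortzWedhorn2023, (27.35.2)] [cite: MumfordAV1970, §4 (rational points)] -/
theorem map_hom_mul (χ : A ⟶ B) (R S : A.Points L) :
    AlgPoints.map χ.hom.hom.hom (R * S) = AlgPoints.map χ.hom.hom.hom R * AlgPoints.map χ.hom.hom.hom S := by
  have h := map_mul (IsMonHom.monoidHom χ.hom.hom.hom (Literature.AlgebraicGeometry.Motives.specOver K L)) R S
  simpa only [IsMonHom.monoidHom_apply, AlgPoints.map_apply] using h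

/-- **A homomorphism commutes with integer powers on `L`-points**: `χ(Rⁿ) = χ(R)ⁿ`.
[cite: GortzWedhorn2023, (27.35.2)] -/
theorem map_hom_zpow (χ : A ⟶ B) (R : A.Points L) (n : ℤ) :
    AlgPoints.map χ.hom.hom.hom (R ^ n) = AlgPoints.map χ.hom.hom.hom R ^ n := by
  have h := map_zpow (IsMonHom.monoidHom χ.hom.hom.hom (Literature.AlgebraicGeometry.Motives.specOver K L)) R n
  simpa only [IsMonHom.monoidHom_apply, AlgPoints.map_apply] using h

/-- **`[n]_A` is the `n`-th power on `L`-points**: `(n • 𝟙 A)(R) = Rⁿ` (Görtz–Wedhorn II (27.35.2); the tree's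
`hom_zsmul_id`). [cite: GortzWedhorn2023, (27.35.2)] -/
theorem map_zsmul_id_hom (n : ℤ) (R : A.Points L) :
    AlgPoints.map ((n • 𝟙 A :).hom.hom.hom) R = R ^ n := by
  rw [AlgPoints.map_apply, hom_zsmul_id, GrpObj.comp_zpow, Category.comp_id]

/-- **`(n • χ)(R) = χ(R)ⁿ` on `L`-points** (`n • χ = χ ≫ [n]_B`). [cite: GortzWedhorn2023, (27.35.2)]
[cite: MumfordAV1970, §19 (first paragraph)] -/
theorem map_zsmul_hom (n : ℤ) (χ : A ⟶ B) (R : A.Points L) :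
    AlgPoints.map ((n • χ :).hom.hom.hom) R = AlgPoints.map χ.hom.hom.hom R ^ n := by
  have h : n • χ = χ ≫ (n • 𝟙 B) := by rw [Preadditive.comp_zsmul, Category.comp_id]
  rw [h]
  have hc : AlgPoints.map (χ ≫ (n • 𝟙 B)).hom.hom.hom R =
      AlgPoints.map (n • 𝟙 B :).hom.hom.hom (AlgPoints.map χ.hom.hom.hom R) :=
    (Category.assoc _ _ _).symm
  rw [hc, map_zsmul_id_hom]

/-- The zero homomorphism is the constant `1` on `L`-points (universe-polymorphic copy of the tree's
`map_hom_zero`). [cite: MumfordAV1970, §19 (first paragraph)] -/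
private theorem map_hom_zero_u (R : A.Points L) : AlgPoints.map (0 : A ⟶ B).hom.hom.hom R = 1 := by
  rw [AlgPoints.map_apply, hom_zero, Grp.Hom.hom_one, Mon.Hom.hom_one, MonObj.comp_one]

/-- Addition of homomorphisms is pointwise on `L`-points (universe-polymorphic copy of the tree's
`map_hom_add`). [cite: MumfordAV1970, §19 (first paragraph)] -/
private theorem map_hom_add_u (u v : A ⟶ B) (R : A.Points L) :
    AlgPoints.map (u + v).hom.hom.hom R = AlgPoints.map u.hom.hom.hom R * AlgPoints.map v.hom.hom.hom R := by
  rw [AlgPoints.map_apply, hom_add, Grp.Hom.hom_mul, Mon.Hom.hom_mul, MonObj.comp_mul]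
  rfl

/-- **A finite sum of homomorphisms acts on `L`-points as the product of the values**:
`(Σᵢ uᵢ)(R) = ∏ᵢ uᵢ(R)` (Mumford §19: `Hom(A, B)` with pointwise addition). [cite: MumfordAV1970, §19 (first paragraph)] -/
theorem map_hom_finset_sum {I : Type*} (s : Finset I) (u : I → (A ⟶ B)) (R : A.Points L) :
    AlgPoints.map (∑ i ∈ s, u i).hom.hom.hom R = ∏ i ∈ s, AlgPoints.map (u i).hom.hom.hom R := by
  classical
  induction s using Finset.induction_on with
  | empty => rw [Finset.sum_empty, Finset.prod_empty, map_hom_zero_u]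
  | insert i s hi ih => rw [Finset.sum_insert hi, Finset.prod_insert hi, map_hom_add_u, ih]

/-- An ADDITIVE parametrisation `P : V → A(L)` (`P (x + y) = P x · P y`) sends `n • x` to `P(x)ⁿ`. [folklore] -/
private theorem apply_nsmul_eq_pow_of_add {V : Type*} [AddCommGroup V] (P : V → A.Points L)
    (hP : ∀ x y, P (x + y) = P x * P y) (n : ℕ) (x : V) : P (n • x) = P x ^ n := by
  have hP0 : P 0 = 1 := by
    have h := hP 0 0
    rw [add_zero] at h
    exact (mul_eq_left.mp h.symm)
  induction n with
  | zero => rw [zero_smul, pow_zero, hP0]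
  | succ n ih => rw [succ_nsmul, hP, ih, pow_succ]

end Points

/-! ### §2 The division lemma -/

section Division

variable {K : Type u} [Field K] [CharZero K] {A B : AbelianVariety K}
  (L : Type u) [Field L] [Algebra K L] [IsAlgClosed L]

/-- **Dividing a homomorphism by `n` on torsion parametrisations.**  Let `P : V → A(L)` be an additive map (and `Q : V → B(L)` any
map) out of an additive group `V` divisible by `n ≥ 1`, with every `n`-torsion point of `A(L)` a value of `P` and
`Ker P ⊆ Ker Q`, and let `φ : A → B` satisfy `φ(P x) = Q(n • x)` for all `x`.  Then `φ = n • χ` for a homomorphism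
`χ : A → B` with `χ(P x) = Q x` for all `x`.  (Milne 1986 Lemma 12.6: a homomorphism killing `A[n](L)` is divisible
by `n`; then `χ(P(n•y)) = χ(P y)ⁿ = φ(P y) = Q(n•y)`.)  The division step behind [Shimura1998] Thm. 18.6 for
non-maximal orders (p. 128) and [Milne2005ShimuraVarieties] Thm. 11.2 («unique `E`-linear isogeny `α` with
`α(N_Φ(s)·x) = σx`»), with `P = σ ∘ u_a`, `Q = u_{r·a} ∘ N_Φ(s)`.
[cite: Milne1986AbelianVarieties, §12 Lemma 12.6 (PDF p. 191)] [cite: Shimura1998, §18.6 proof of Thm. 18.6, p. 128]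
[cite: Milne2005ShimuraVarieties, §11 Thm. 11.2, p. 108] -/
theorem exists_eq_zsmul_and_map_eq_of_map_eq_nsmul {V : Type*} [AddCommGroup V] (n : ℕ) (hn : (n : K) ≠ 0)
    (hdiv : ∀ x : V, ∃ y : V, n • y = x) (P : V → A.Points L) (hP : ∀ x y, P (x + y) = P x * P y)
    (Q : V → B.Points L)
    (htors : ∀ T ∈ A.torsionPoints L n, ∃ x, P x = T) (hker : ∀ x, P x = 1 → Q x = 1) (φ : A ⟶ B)
    (hφ : ∀ x, AlgPoints.map φ.hom.hom.hom (P x) = Q (n • x)) :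
    ∃ χ : A ⟶ B, φ = (n : ℤ) • χ ∧ ∀ x, AlgPoints.map χ.hom.hom.hom (P x) = Q x := by
  -- `φ` kills `A[n](L)`
  have hkill : ∀ T ∈ A.torsionPoints L n,
      (T ≫ φ.hom.hom.hom : Literature.AlgebraicGeometry.Motives.specOver K L ⟶ B.X) = 1 := by
    intro T hT
    obtain ⟨x, rfl⟩ := htors T hT
    have hTn : P x ^ (n : ℤ) = 1 := (mem_torsionPoints_iff (n : ℤ) (P x)).1 hT
    have hPn : P (n • x) = 1 := by rw [apply_nsmul_eq_pow_of_add P hP n x, ← zpow_natCast, hTn]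
    have hQn : Q (n • x) = 1 := hker _ hPn
    rw [← AlgPoints.map_apply, hφ, hQn]
  obtain ⟨χ, hχ⟩ := exists_eq_zsmul_of_forall_torsionPoints_of_isAlgClosed L (n : ℤ)
    (by exact_mod_cast hn) φ hkill
  refine ⟨χ, hχ, fun x => ?_⟩
  obtain ⟨y, rfl⟩ := hdiv x
  -- `χ(P(n•y)) = χ(P y)ⁿ = (n•χ)(P y) = φ(P y) = Q(n•y)`
  rw [apply_nsmul_eq_pow_of_add P hP n y, ← zpow_natCast, map_hom_zpow, ← map_zsmul_hom, ← hχ, hφ]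

/-- The conclusion one uses: **there is `χ : A → B` with `χ(P x) = Q x` for all `x`** (hypotheses as in
`exists_eq_zsmul_and_map_eq_of_map_eq_nsmul`). [cite: Milne1986AbelianVarieties, §12 Lemma 12.6 (PDF p. 191)]
[cite: Milne2005ShimuraVarieties, §11 Thm. 11.2, p. 108] -/
theorem exists_map_eq_of_map_eq_nsmul {V : Type*} [AddCommGroup V] (n : ℕ) (hn : (n : K) ≠ 0)
    (hdiv : ∀ x : V, ∃ y : V, n • y = x) (P : V → A.Points L) (hP : ∀ x y, P (x + y) = P x * P y)
    (Q : V → B.Points L)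
    (htors : ∀ T ∈ A.torsionPoints L n, ∃ x, P x = T) (hker : ∀ x, P x = 1 → Q x = 1) (φ : A ⟶ B)
    (hφ : ∀ x, AlgPoints.map φ.hom.hom.hom (P x) = Q (n • x)) :
    ∃ χ : A ⟶ B, ∀ x, AlgPoints.map χ.hom.hom.hom (P x) = Q x := by
  obtain ⟨χ, -, h⟩ := exists_eq_zsmul_and_map_eq_of_map_eq_nsmul L n hn hdiv P hP Q htors hker φ hφ
  exact ⟨χ, h⟩

end Division

end Literature.AlgebraicGeometry.Motives.AbelianVariety

end
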